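import Literature.Analysis.FunctionSpaces.BochnerProofs
import Literature.Analysis.UnboundedOperators.FourierSpectrum
import Mathlib.MeasureTheory.Measure.CharacteristicFunction.Basic
import Mathlib.LinearAlgebra.BilinearForm.Properties
import Mathlib.Topology.Algebra.Module.FiniteDimension
import Mathlib.MeasureTheory.Integral.Prod
import Mathlib.MeasureTheory.Integral.DominatedConvergence
import HarnessLib

/-!
# Spectral measures of unitary representations of `ℝ^d` (Stone–Bochner–Herglotz)

Topic `Analysis/UnboundedOperators`; namespace `Literature.Analysis.UnboundedOperators`. Proof file
(one auxiliary definition with body, theorems) complementing `UnitaryRep` (strongly continuous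
unitary representations, bundled) and `FourierSpectrum` (matrix coefficients `matrixCoeff` and their
DISTRIBUTIONAL Fourier transforms, "without SNAG") with the scalar half of the SNAG theorem: the
diagonal matrix coefficients `matrixCoeff U v v` of a unitary representation
`U : UnitaryRep (Multiplicative V) H` of the additive group of a finite-dimensional real vector space
`V` are Fourier transforms of finite positive MEASURES (Stone (1930/32); Riesz–Sz.-Nagy, *Functional
analysis* (1955), §§137–138; Folland, *A course in abstract harmonic analysis* (1995), Prop. 3.35 and
Thm. 4.44). Only Bochner's theorem is used, no projection-valued measures:

* `sum_sum_matrixCoeff_eq`, `isPositiveDefinite_matrixCoeff` — the diagonal matrix coefficient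
  `x ↦ ⟪v, U x v⟫` is positive definite (`∑ᵢⱼ c̄ᵢ cⱼ ⟪v, U (xⱼ - xᵢ) v⟫ = ‖∑ cᵢ U xᵢ v‖²`);
* `exists_spectralMeasure`, `spectralMeasure` (**Stone–Bochner**) — for a non-degenerate bilinear
  form `B` on `V` (used to identify `V` with its dual: the characters of `V` are
  `x ↦ exp(i B(ξ, x))`, `ξ ∈ V`) every `v ∈ H` has a unique finite Borel measure `μ_v` on `V`, of
  mass `‖v‖²`, with `⟪v, U x v⟫ = ∫ exp(i B(ξ, x)) dμ_v(ξ)`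
  (`matrixCoeff_eq_integral_spectralMeasure`, `spectralMeasure_univ`, `spectralMeasure_unique`);
  Bochner's theorem is the tree's `IsPositiveDefinite.exists_charFun_eq_holds` on a Euclidean model
  of `V`, transported;
* `norm_sq_integral_smul_map_eq` (**Plancherel formula for the integrated representation**) — for
  `f ∈ L¹(V, λ)` (any measure `λ`),
  `‖∫ f(x) U_x v dλ(x)‖² = ∫ |∫ f(x) exp(i B(ξ, x)) dλ(x)|² dμ_v(ξ)`
  (`continuous_integral_mul_cexp_bilin`: the inner transform is continuous in `ξ`);
* `spectralMeasure_eq_map_of_matrixCoeff_eq` (**covariance**) — if `⟪w, U x w⟫ = ⟪v, U (A x) v⟫`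
  for a linear `A` with `B`-adjoint `A'` (e.g. `w = D v` for a unitary `D` with `D⁻¹ U_x D = U_{A x}`),
  then `μ_w` is the push-forward of `μ_v` under `A'`, and the Plancherel formula for `w` reads on
  `μ_v` (`norm_sq_integral_smul_map_eq_of_matrixCoeff_eq`);
* `lintegral_weight_mul_norm_sq_integral_smul_le` (**dilation integral**) — for an abelian group `Y`
  acting linearly on `V` by `B`-symmetric maps, a family `w_y` with the dilated matrix coefficients of
  `v`, a left-invariant measure `ν` on `Y`, weights `χ` (multiplicative on `Y`) and `W` on `V` with
  `W(y · ξ) = χ(y) W(ξ)`, `W(ξ₀) = 1`, and a kernel `f` whose `B`-transform vanishes off the orbit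
  `Y · ξ₀`: `∫_Y χ(y) ‖∫ f(x) U_x w_y‖² dν ≤ (∫_Y χ(z) |f̂(z⁻¹ · ξ₀)|² dν) · ∫_V W dμ_v` — Plancherel,
  Tonelli and the substitution `y = u z` on the orbit (the abelian half of the `L²`-bound of
  Whittaker coefficients along a torus).

These are the inputs of the soft `L²`-bounds for Whittaker coefficients along archimedean torus
orbits (Rankin–Selberg theory at `s = 1`, `NumberTheory/Automorphic`), where `U` is the restriction
(`UnitaryRep.restrict`) of the right regular representation to an archimedean unipotent line.

## References

* M. H. Stone, *On one-parameter unitary groups in Hilbert space*, Ann. of Math. 33 (1932),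
  643–648 [Stone1932].
* S. Bochner, *Monotone Funktionen, Stieltjessche Integrale und harmonische Analyse*, Math. Ann.
  108 (1933), Satz 22 [Bochner1933].
* G. B. Folland, *A course in abstract harmonic analysis* (1995), Prop. 3.35, §4.4 Thm. 4.44
  [Folland1995].
-/

noncomputable section

open scoped ComplexConjugate InnerProductSpace ENNReal
open MeasureTheory Complex Filter Topology
open Literature.Analysis.FunctionSpaces

namespace Literature.Analysis.UnboundedOperators

namespace UnitaryRep

/-! ### Diagonal matrix coefficients are positive definite -/

section Group

variable {V : Type*} [NormedAddCommGroup V]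
  {H : Type*} [NormedAddCommGroup H] [InnerProductSpace ℂ H] [CompleteSpace H]
  (U : UnitaryRep (Multiplicative V) H)

omit [CompleteSpace H] in
/-- `⟪v, v⟫ = ‖v‖²` with the coercion `ℝ → ℂ`. [folklore] -/
theorem _root_.Literature.Analysis.UnboundedOperators.inner_self_eq_coe_norm_sq (v : H) :
    ⟪v, v⟫_ℂ = ((‖v‖ ^ 2 : ℝ) : ℂ) := by
  rw [inner_self_eq_norm_sq_to_K]; norm_cast

/-- `U (x + y) v = U x (U y v)` (additive notation for the translation group). [folklore] -/
theorem map_ofAdd_add_apply (x y : V) (v : H) :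
    U (Multiplicative.ofAdd (x + y)) v = U (Multiplicative.ofAdd x) (U (Multiplicative.ofAdd y) v) := by
  rw [ofAdd_add, map_mul]; rfl

/-- `U 0 = id`. [folklore] -/
theorem map_ofAdd_zero_apply (v : H) : U (Multiplicative.ofAdd (0 : V)) v = v := by
  rw [ofAdd_zero, map_one]; rfl

/-- The adjoint relation `⟪U x v, w⟫ = ⟪v, U (-x) w⟫`. [folklore] -/
theorem inner_map_ofAdd_left_eq (x : V) (v w : H) :
    ⟪U (Multiplicative.ofAdd x) v, w⟫_ℂ = ⟪v, U (Multiplicative.ofAdd (-x)) w⟫_ℂ := by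
  have h : U (Multiplicative.ofAdd x) (U (Multiplicative.ofAdd (-x)) w) = w := by
    rw [← U.map_ofAdd_add_apply, add_neg_cancel, U.map_ofAdd_zero_apply]
  conv_lhs => rw [← h]
  exact U.inner_map_map _ v _

/-- Matrix coefficients: `⟪U x v, U y v⟫ = ⟪v, U (y - x) v⟫`. [folklore] -/
theorem inner_map_ofAdd_map_ofAdd_eq (x y : V) (v : H) :
    ⟪U (Multiplicative.ofAdd x) v, U (Multiplicative.ofAdd y) v⟫_ℂ = ⟪v, U (Multiplicative.ofAdd (y - x)) v⟫_ℂ := by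
  rw [U.inner_map_ofAdd_left_eq, ← U.map_ofAdd_add_apply, neg_add_eq_sub]

/-- **Positive-definiteness of diagonal matrix coefficients**: for every finite family,
`∑ᵢ ∑ⱼ c̄ᵢ cⱼ ⟪v, U (xⱼ - xᵢ) v⟫ = ‖∑ᵢ cᵢ U xᵢ v‖²` (as an inner product). [cite: Folland1995, Prop. 3.35] -/
theorem sum_sum_matrixCoeff_eq (v : H) {n : ℕ} (x : Fin n → V) (c : Fin n → ℂ) :
    ∑ i, ∑ j, conj (c i) * c j * U.matrixCoeff v v (x j - x i) =
      ⟪∑ i, c i • U (Multiplicative.ofAdd (x i)) v, ∑ i, c i • U (Multiplicative.ofAdd (x i)) v⟫_ℂ := by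
  rw [sum_inner]
  refine Finset.sum_congr rfl fun i _ => ?_
  rw [inner_sum]
  refine Finset.sum_congr rfl fun j _ => ?_
  rw [inner_smul_left, inner_smul_right, U.inner_map_ofAdd_map_ofAdd_eq, matrixCoeff_apply]
  ring

/-- **The diagonal matrix coefficient `x ↦ ⟪v, U x v⟫` of a unitary representation is positive
definite** (in the sense of `IsPositiveDefinite`, Bochner 1933 §1). [cite: Folland1995, Prop. 3.35] -/
theorem isPositiveDefinite_matrixCoeff (v : H) : IsPositiveDefinite (U.matrixCoeff v v) := by
  intro n x c
  rw [U.sum_sum_matrixCoeff_eq v x c, inner_self_eq_coe_norm_sq]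
  exact ⟨by rw [Complex.ofReal_re]; positivity, Complex.ofReal_im _⟩

end Group

/-- Positive-definiteness is stable under multiplication by a non-negative real. [folklore] -/
theorem _root_.Literature.Analysis.FunctionSpaces.IsPositiveDefinite.real_smul {V : Type*} [AddCommGroup V]
    {C : V → ℂ} (hC : IsPositiveDefinite C) {r : ℝ} (hr : 0 ≤ r) :
    IsPositiveDefinite fun x => (r : ℂ) * C x := by
  intro n x c
  have h1 : ∑ i, ∑ j, conj (c i) * c j * ((r : ℂ) * C (x j - x i)) =
      (r : ℂ) * ∑ i, ∑ j, conj (c i) * c j * C (x j - x i) := by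
    rw [Finset.mul_sum]
    refine Finset.sum_congr rfl fun i _ => ?_
    rw [Finset.mul_sum]
    refine Finset.sum_congr rfl fun j _ => ?_
    ring
  simp only []
  rw [h1, Complex.re_ofReal_mul, Complex.im_ofReal_mul, (hC n x c).2, mul_zero]
  exact ⟨mul_nonneg hr (hC n x c).1, rfl⟩

/-- Positive-definiteness is stable under precomposition with an additive homomorphism. [folklore] -/
theorem _root_.Literature.Analysis.FunctionSpaces.IsPositiveDefinite.comp_addMonoidHom {V V' : Type*}
    [AddCommGroup V] [AddCommGroup V'] {C : V → ℂ}
    (hC : IsPositiveDefinite C) (e : V' →+ V) : IsPositiveDefinite fun x => C (e x) := by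
  intro n x c
  have h := hC n (fun i => e (x i)) c
  simp only [← map_sub] at h
  exact h

/-! ### The spectral measure (Stone–Bochner) -/

section Spectral

variable {V : Type*} [NormedAddCommGroup V] [NormedSpace ℝ V] [FiniteDimensional ℝ V]
  [MeasurableSpace V] [BorelSpace V]
  {H : Type*} [NormedAddCommGroup H] [InnerProductSpace ℂ H] [CompleteSpace H]

omit [FiniteDimensional ℝ V] [MeasurableSpace V] [BorelSpace V] in
/-- The character `ξ ↦ exp(i B(ξ, x))` has norm one. [folklore] -/
theorem _root_.Literature.Analysis.UnboundedOperators.norm_cexp_bilin_mul_I (B : LinearMap.BilinForm ℝ V) (ξ x : V) :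
    ‖cexp ((B ξ x : ℝ) * I)‖ = 1 := by
  rw [Complex.norm_exp_ofReal_mul_I]

omit [MeasurableSpace V] [BorelSpace V] in
/-- A bilinear form on a finite-dimensional space is jointly continuous. [folklore] -/
theorem _root_.Literature.Analysis.UnboundedOperators.continuous_bilin_uncurry (B : LinearMap.BilinForm ℝ V) :
    Continuous fun p : V × V => B p.1 p.2 := by
  set Bc : V →L[ℝ] V →L[ℝ] ℝ :=
    LinearMap.toContinuousLinearMap
      ((LinearMap.toContinuousLinearMap : (V →ₗ[ℝ] ℝ) ≃ₗ[ℝ] (V →L[ℝ] ℝ)).toLinearMap ∘ₗ B) with hBc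
  have h : ∀ p : V × V, B p.1 p.2 = Bc p.1 p.2 := fun p => rfl
  simp_rw [h]
  exact Bc.continuous₂

omit [MeasurableSpace V] [BorelSpace V] in
/-- The characters `(ξ, x) ↦ exp(i B(ξ, x))` are jointly continuous. [folklore] -/
theorem _root_.Literature.Analysis.UnboundedOperators.continuous_cexp_bilin_uncurry (B : LinearMap.BilinForm ℝ V) :
    Continuous fun p : V × V => cexp ((B p.1 p.2 : ℝ) * I) :=
  Complex.continuous_exp.comp ((Complex.continuous_ofReal.comp (continuous_bilin_uncurry B)).mul
    continuous_const)

/-- The character integrand is integrable against a finite measure. [folklore] -/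
theorem _root_.Literature.Analysis.UnboundedOperators.integrable_cexp_bilin (B : LinearMap.BilinForm ℝ V)
    (μ : Measure V) [IsFiniteMeasure μ] (x : V) : Integrable (fun ξ => cexp ((B ξ x : ℝ) * I)) μ := by
  refine (integrable_const (1 : ℝ)).mono' ?_ (ae_of_all _ fun ξ => (norm_cexp_bilin_mul_I B ξ x).le)
  exact ((continuous_cexp_bilin_uncurry B).comp
    (continuous_id.prodMk continuous_const)).aestronglyMeasurable

/-- **The `B`-Fourier transform of an `L¹` function is continuous** (dominated convergence with the
bound `|f|`). [folklore] -/
theorem _root_.Literature.Analysis.UnboundedOperators.continuous_integral_mul_cexp_bilin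
    (B : LinearMap.BilinForm ℝ V) (lam : Measure V) {f : V → ℂ} (hf : Integrable f lam) :
    Continuous fun ξ : V => ∫ x, f x * cexp ((B ξ x : ℝ) * I) ∂lam := by
  refine continuous_of_dominated (bound := fun x => ‖f x‖) (fun ξ => ?_) (fun ξ => ae_of_all _ fun x => ?_)
    hf.norm (ae_of_all _ fun x => ?_)
  · exact hf.1.mul ((continuous_cexp_bilin_uncurry B).comp
      (continuous_const.prodMk continuous_id)).aestronglyMeasurable
  · rw [norm_mul, norm_cexp_bilin_mul_I, mul_one]
  · exact continuous_const.mul ((continuous_cexp_bilin_uncurry B).comp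
      (continuous_id.prodMk continuous_const))

/-- **Uniqueness of the spectral measure**: a finite measure is determined by the integrals of
the characters `exp(i B(ξ, x))`, `x ∈ V`, for `B` non-degenerate (Lévy; Mathlib
`ext_of_integral_char_eq`). [cite: Folland1995, Thm. 4.44] -/
theorem _root_.Literature.Analysis.UnboundedOperators.measure_eq_of_forall_integral_cexp_bilin_eq
    (B : LinearMap.BilinForm ℝ V)
    (hB : B.Nondegenerate) {μ ν : Measure V} [IsFiniteMeasure μ] [IsFiniteMeasure ν]
    (h : ∀ x, ∫ ξ, cexp ((B ξ x : ℝ) * I) ∂μ = ∫ ξ, cexp ((B ξ x : ℝ) * I) ∂ν) :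
    μ = ν := by
  haveI : CompleteSpace V := FiniteDimensional.complete ℝ V
  refine ext_of_integral_char_eq (e := Real.probChar) (L := B) Real.continuous_probChar
    Real.probChar_ne_one (fun ξ hξ => ?_) (continuous_bilin_uncurry B) fun x => ?_
  · intro hzero
    exact hξ (hB.1 ξ fun y => by rw [hzero]; rfl)
  · have e1 : ∀ ρ : Measure V, ∫ ξ, BoundedContinuousFunction.char Real.continuous_probChar
        (continuous_bilin_uncurry B) x ξ ∂ρ = ∫ ξ, cexp ((B ξ x : ℝ) * I) ∂ρ := by
      intro ρ
      refine integral_congr_ae (ae_of_all _ fun ξ => ?_)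
      rw [BoundedContinuousFunction.char_apply, Real.probChar_apply]
    rw [e1, e1, h x]

variable (U : UnitaryRep (Multiplicative V) H)

/-- **Stone–Bochner: existence of the spectral measure.** For a (strongly continuous) unitary
representation `U` of the additive group of a finite-dimensional real vector space `V` and a
non-degenerate bilinear form `B` on `V`, every vector `v` has a finite Borel measure `μ` on `V`
with `⟪v, U x v⟫ = ∫ exp(i B(ξ, x)) dμ(ξ)` for all `x`. Proof: the matrix coefficient is
continuous, positive definite with value `‖v‖²` at `0`; on a Euclidean model `E ≃ V` Bochner's
theorem (`IsPositiveDefinite.exists_charFun_eq_holds`) gives a probability measure with this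
characteristic function, which is transported back to `V` along the isomorphism `E → V` dual,
through `B`, to `E ≃ V`. [cite: Folland1995, Thm. 4.44] [cite: Bochner1933, Satz 22] -/
theorem exists_spectralMeasure (B : LinearMap.BilinForm ℝ V) (hB : B.Nondegenerate) (v : H) :
    ∃ μ : Measure V, IsFiniteMeasure μ ∧
      ∀ x, U.matrixCoeff v v x = ∫ ξ, cexp ((B ξ x : ℝ) * I) ∂μ := by
  by_cases hv : v = 0
  · refine ⟨0, inferInstance, fun x => ?_⟩
    simp [hv]
  -- a Euclidean model of `V`
  set d : ℕ := Module.finrank ℝ V with hd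
  have hdim : Module.finrank ℝ V = Module.finrank ℝ (EuclideanSpace ℝ (Fin d)) :=
    finrank_euclideanSpace_fin.symm
  set e : V ≃L[ℝ] EuclideanSpace ℝ (Fin d) := ContinuousLinearEquiv.ofFinrankEq hdim with he
  -- the normalised matrix coefficient on the model
  have hv2 : (0 : ℝ) < ‖v‖ ^ 2 := by positivity
  set C : EuclideanSpace ℝ (Fin d) → ℂ := fun s => ((‖v‖ ^ 2)⁻¹ : ℝ) * U.matrixCoeff v v (e.symm s) with hC
  have hCpd : IsPositiveDefinite C := by
    have h1 : IsPositiveDefinite fun s : EuclideanSpace ℝ (Fin d) => U.matrixCoeff v v (e.symm s) :=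
      (U.isPositiveDefinite_matrixCoeff v).comp_addMonoidHom
        (e.symm.toLinearEquiv.toLinearMap.toAddMonoidHom)
    exact h1.real_smul (inv_nonneg.2 hv2.le)
  have hCc : Continuous C := continuous_const.mul ((U.continuous_matrixCoeff v v).comp e.symm.continuous)
  have hC0 : C 0 = 1 := by
    simp only [hC, map_zero, matrixCoeff_apply, U.map_ofAdd_zero_apply, inner_self_eq_coe_norm_sq]
    rw [← Complex.ofReal_mul, inv_mul_cancel₀ hv2.ne', Complex.ofReal_one]
  obtain ⟨μ', hμ'P, hμ'C⟩ :=
    (IsPositiveDefinite.exists_charFun_eq_holds (V := EuclideanSpace ℝ (Fin d))) hCpd hCc hC0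
  -- transport: `Φ : E → V` with `B (Φ s) x = ⟪s, e x⟫`
  set Φ' : EuclideanSpace ℝ (Fin d) →ₗ[ℝ] Module.Dual ℝ V :=
    e.toLinearEquiv.toLinearMap.dualMap ∘ₗ (innerₗ (EuclideanSpace ℝ (Fin d))) with hΦ'
  set Φ : EuclideanSpace ℝ (Fin d) →ₗ[ℝ] V := (B.toDual hB).symm.toLinearMap ∘ₗ Φ' with hΦ
  have hΦB : ∀ s x, B (Φ s) x = ⟪s, e x⟫_ℝ := by
    intro s x
    simp only [hΦ, hΦ', LinearMap.coe_comp, LinearEquiv.coe_coe, Function.comp_apply,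
      LinearMap.BilinForm.apply_toDual_symm_apply, LinearMap.dualMap_apply]
    rfl
  have hΦc : Continuous Φ := LinearMap.continuous_of_finiteDimensional Φ
  have hΦm : Measurable Φ := hΦc.measurable
  haveI : IsFiniteMeasure (μ'.map Φ) := Measure.isFiniteMeasure_map μ' Φ
  refine ⟨ENNReal.ofReal (‖v‖ ^ 2) • μ'.map Φ, ?_, fun x => ?_⟩
  · exact ⟨by
      rw [Measure.smul_apply, smul_eq_mul]
      exact ENNReal.mul_lt_top ENNReal.ofReal_lt_top (measure_lt_top _ _)⟩
  · have hint : ∫ ξ, cexp ((B ξ x : ℝ) * I) ∂(ENNReal.ofReal (‖v‖ ^ 2) • μ'.map Φ) =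
        (‖v‖ ^ 2 : ℝ) * ∫ ξ, cexp ((B ξ x : ℝ) * I) ∂(μ'.map Φ) := by
      rw [integral_smul_measure, ENNReal.toReal_ofReal hv2.le, Complex.real_smul]
    have hmap : ∫ ξ, cexp ((B ξ x : ℝ) * I) ∂(μ'.map Φ) = ∫ s, cexp ((B (Φ s) x : ℝ) * I) ∂μ' :=
      integral_map hΦm.aemeasurable ((continuous_cexp_bilin_uncurry B).comp
        (continuous_id.prodMk continuous_const)).aestronglyMeasurable
    rw [hint, hmap]
    simp_rw [hΦB]
    have hchar : ∫ s, cexp ((⟪s, e x⟫_ℝ : ℝ) * I) ∂μ' = C (e x) := by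
      rw [← hμ'C, charFun_apply]
    rw [hchar]
    simp only [hC, ContinuousLinearEquiv.symm_apply_apply]
    rw [← mul_assoc, ← Complex.ofReal_mul, mul_inv_cancel₀ hv2.ne', Complex.ofReal_one, one_mul]

/-- **The spectral measure** `μ_v` of the vector `v` for the unitary representation `U`, with
respect to the identification of `V` with its dual through the non-degenerate form `B`
(`⟪v, U x v⟫ = ∫ exp(i B(ξ, x)) dμ_v(ξ)`; a choice from `exists_spectralMeasure`).
[cite: Folland1995, Thm. 4.44] -/
def spectralMeasure (B : LinearMap.BilinForm ℝ V) (hB : B.Nondegenerate) (v : H) : Measure V :=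
  (U.exists_spectralMeasure B hB v).choose

variable (B : LinearMap.BilinForm ℝ V)

/-- The spectral measure is finite. [folklore] -/
instance isFiniteMeasure_spectralMeasure (hB : B.Nondegenerate) (v : H) : IsFiniteMeasure (U.spectralMeasure B hB v) :=
  (U.exists_spectralMeasure B hB v).choose_spec.1

/-- **The defining identity of the spectral measure**: `⟪v, U x v⟫ = ∫ exp(i B(ξ, x)) dμ_v(ξ)`.
[cite: Folland1995, Thm. 4.44] -/
theorem matrixCoeff_eq_integral_spectralMeasure (hB : B.Nondegenerate) (v : H) (x : V) :
    U.matrixCoeff v v x = ∫ ξ, cexp ((B ξ x : ℝ) * I) ∂(U.spectralMeasure B hB v) :=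
  (U.exists_spectralMeasure B hB v).choose_spec.2 x

/-- The defining identity, applied form: `⟪v, U (ofAdd x) v⟫ = ∫ exp(i B(ξ, x)) dμ_v(ξ)`. [folklore] -/
theorem inner_map_eq_integral_spectralMeasure (hB : B.Nondegenerate) (v : H) (x : V) :
    ⟪v, U (Multiplicative.ofAdd x) v⟫_ℂ = ∫ ξ, cexp ((B ξ x : ℝ) * I) ∂(U.spectralMeasure B hB v) :=
  U.matrixCoeff_eq_integral_spectralMeasure B hB v x

/-- **The mass of the spectral measure is `‖v‖²`.** [cite: Folland1995, Thm. 4.44] -/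
theorem spectralMeasure_real_univ (hB : B.Nondegenerate) (v : H) : (U.spectralMeasure B hB v).real Set.univ = ‖v‖ ^ 2 := by
  have h := U.inner_map_eq_integral_spectralMeasure B hB v 0
  simp only [map_zero, Complex.ofReal_zero, zero_mul, Complex.exp_zero, integral_const,
    Complex.real_smul, mul_one, U.map_ofAdd_zero_apply, inner_self_eq_coe_norm_sq] at h
  exact (Complex.ofReal_injective h).symm

/-- The mass of the spectral measure in `ℝ≥0∞`. [folklore] -/
theorem spectralMeasure_univ (hB : B.Nondegenerate) (v : H) :
    U.spectralMeasure B hB v Set.univ = ENNReal.ofReal (‖v‖ ^ 2) := by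
  rw [← U.spectralMeasure_real_univ B hB v, Measure.real, ENNReal.ofReal_toReal (measure_ne_top _ _)]

/-- The spectral measure is the unique finite measure with the defining identity. [folklore] -/
theorem spectralMeasure_unique (hB : B.Nondegenerate) (v : H) {μ : Measure V} [IsFiniteMeasure μ]
    (h : ∀ x, ⟪v, U (Multiplicative.ofAdd x) v⟫_ℂ = ∫ ξ, cexp ((B ξ x : ℝ) * I) ∂μ) :
    U.spectralMeasure B hB v = μ :=
  measure_eq_of_forall_integral_cexp_bilin_eq B hB fun x => by
    rw [← U.inner_map_eq_integral_spectralMeasure B hB v x, h x]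

/-! ### The Plancherel formula for the integrated representation -/

omit [FiniteDimensional ℝ V] [MeasurableSpace V] [BorelSpace V] in
/-- `exp(i B(ξ, y - x)) = exp(i B(ξ, y)) · conj (exp(i B(ξ, x)))`. [folklore] -/
theorem _root_.Literature.Analysis.UnboundedOperators.cexp_bilin_sub (ξ x y : V) :
    cexp ((B ξ (y - x) : ℝ) * I) = cexp ((B ξ y : ℝ) * I) * conj (cexp ((B ξ x : ℝ) * I)) := by
  rw [← Complex.exp_conj, map_mul, Complex.conj_ofReal, Complex.conj_I, ← Complex.exp_add, map_sub,
    Complex.ofReal_sub]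
  ring_nf

/-- The integrated vector `∫ f(x) U_x v dλ` has an integrable integrand for `f ∈ L¹(λ)`. [folklore] -/
theorem integrable_smul_map_ofAdd (v : H) (lam : Measure V) {f : V → ℂ} (hf : Integrable f lam) :
    Integrable (fun x => f x • U (Multiplicative.ofAdd x) v) lam := by
  refine Integrable.mono' (hf.norm.mul_const ‖v‖)
    (hf.1.smul ((U.continuous_apply_apply v).comp continuous_ofAdd).aestronglyMeasurable)
    (ae_of_all _ fun x => ?_)
  rw [norm_smul, U.norm_map]

/-- **Plancherel formula for the integrated representation.** For `f ∈ L¹(V, λ)` and the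
spectral measure `μ_v` of `v`,
`‖∫ f(x) U_x v dλ(x)‖² = ∫ |∫ f(x) exp(i B(ξ, x)) dλ(x)|² dμ_v(ξ)`: expand the square as a double
integral of `f̄(x) f(y) ⟪U_x v, U_y v⟫ = f̄(x) f(y) ⟪v, U_{y-x} v⟫`, insert the spectral integral and
exchange the order of integration (Fubini; the integrand is bounded by `|f(x)| |f(y)|`).
[cite: Folland1995, Thm. 4.44] -/
theorem norm_sq_integral_smul_map_eq (hB : B.Nondegenerate) (v : H) (lam : Measure V) [SFinite lam]
    {f : V → ℂ} (hf : Integrable f lam) :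
    ‖∫ x, f x • U (Multiplicative.ofAdd x) v ∂lam‖ ^ 2 =
      ∫ ξ, ‖∫ x, f x * cexp ((B ξ x : ℝ) * I) ∂lam‖ ^ 2 ∂(U.spectralMeasure B hB v) := by
  set μ := U.spectralMeasure B hB v with hμ
  set g : V → H := fun x => f x • U (Multiplicative.ofAdd x) v with hg
  have hgi : Integrable g lam := U.integrable_smul_map_ofAdd v lam hf
  set F : H := ∫ x, g x ∂lam with hF
  -- the kernel `Ψ(x, y) = f̄(x) f(y) ⟪v, U (y - x) v⟫`
  set Ψ : V × V → ℂ := fun p => conj (f p.1) * f p.2 * ⟪v, U (Multiplicative.ofAdd (p.2 - p.1)) v⟫_ℂ with hΨ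
  have hcoef : Continuous fun p : V × V => ⟪v, U (Multiplicative.ofAdd (p.2 - p.1)) v⟫_ℂ :=
    continuous_const.inner (((U.continuous_apply_apply v).comp continuous_ofAdd).comp
      (continuous_snd.sub continuous_fst))
  have hcoef_bd : ∀ p : V × V, ‖⟪v, U (Multiplicative.ofAdd (p.2 - p.1)) v⟫_ℂ‖ ≤ ‖v‖ * ‖v‖ := fun p => by
    calc ‖⟪v, U (Multiplicative.ofAdd (p.2 - p.1)) v⟫_ℂ‖ ≤ ‖v‖ * ‖U (Multiplicative.ofAdd (p.2 - p.1)) v‖ :=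
          norm_inner_le_norm _ _
      _ = ‖v‖ * ‖v‖ := by rw [U.norm_map]
  have hfc : Integrable (fun x => conj (f x)) lam :=
    hf.norm.mono' (Complex.continuous_conj.comp_aestronglyMeasurable hf.1)
      (ae_of_all _ fun x => by rw [Complex.norm_conj])
  have hff : Integrable (fun p : V × V => conj (f p.1) * f p.2) (lam.prod lam) := hfc.mul_prod hf
  have hΨi : Integrable Ψ (lam.prod lam) :=
    hff.mul_bdd hcoef.aestronglyMeasurable (ae_of_all _ hcoef_bd)
  -- step 1: `⟪F, F⟫ = ∫∫ Ψ`
  have h1 : ⟪F, F⟫_ℂ = ∫ p, Ψ p ∂(lam.prod lam) := by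
    have e1 : ⟪F, F⟫_ℂ = ∫ y, ⟪F, g y⟫_ℂ ∂lam := (integral_inner hgi F).symm
    have e2 : ∀ y, ⟪F, g y⟫_ℂ = ∫ x, ⟪g x, g y⟫_ℂ ∂lam := fun y => by
      rw [← inner_conj_symm, ← integral_inner hgi (g y), ← integral_conj]
      exact integral_congr_ae (ae_of_all _ fun x => inner_conj_symm _ _)
    have e3 : ∀ x y, ⟪g x, g y⟫_ℂ = Ψ (x, y) := fun x y => by
      simp only [hg, hΨ, inner_smul_left, inner_smul_right, U.inner_map_ofAdd_map_ofAdd_eq]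
      ring
    rw [e1, integral_prod_symm Ψ hΨi]
    refine integral_congr_ae (ae_of_all _ fun y => ?_)
    dsimp only
    rw [e2 y]
    exact integral_congr_ae (ae_of_all _ fun x => e3 x y)
  -- step 2: insert the spectral integral and swap
  set G : V × V → V → ℂ := fun p ξ => conj (f p.1) * f p.2 * cexp ((B ξ (p.2 - p.1) : ℝ) * I) with hG
  have hGc : Continuous fun q : (V × V) × V => cexp ((B q.2 (q.1.2 - q.1.1) : ℝ) * I) :=
    (continuous_cexp_bilin_uncurry B).comp
      (continuous_snd.prodMk ((continuous_snd.comp continuous_fst).sub (continuous_fst.comp continuous_fst)))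
  have hGi : Integrable (Function.uncurry G) ((lam.prod lam).prod μ) := by
    have h0 : Integrable (fun q : (V × V) × V => conj (f q.1.1) * f q.1.2 * (1 : ℂ)) ((lam.prod lam).prod μ) :=
      hff.mul_prod (integrable_const (1 : ℂ))
    simp only [mul_one] at h0
    exact h0.mul_bdd hGc.aestronglyMeasurable (ae_of_all _ fun q => (norm_cexp_bilin_mul_I B _ _).le)
  have h2 : ∫ p, Ψ p ∂(lam.prod lam) = ∫ p, ∫ ξ, G p ξ ∂μ ∂(lam.prod lam) := by
    refine integral_congr_ae (ae_of_all _ fun p => ?_)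
    simp only [hΨ, hG]
    rw [U.inner_map_eq_integral_spectralMeasure B hB v (p.2 - p.1), ← integral_const_mul]
  have h3 : ∫ p, ∫ ξ, G p ξ ∂μ ∂(lam.prod lam) = ∫ ξ, ∫ p, G p ξ ∂(lam.prod lam) ∂μ :=
    integral_integral_swap hGi
  -- step 3: the inner integral is `|A(ξ)|²`
  set A : V → ℂ := fun ξ => ∫ x, f x * cexp ((B ξ x : ℝ) * I) ∂lam with hA
  have h4 : ∀ ξ, ∫ p, G p ξ ∂(lam.prod lam) = conj (A ξ) * A ξ := by
    intro ξ
    have e1 : ∀ p : V × V, G p ξ = (conj (f p.1) * conj (cexp ((B ξ p.1 : ℝ) * I))) *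
        (f p.2 * cexp ((B ξ p.2 : ℝ) * I)) := fun p => by
      simp only [hG]
      rw [cexp_bilin_sub]
      ring
    simp_rw [e1]
    rw [integral_prod_mul (fun x => conj (f x) * conj (cexp ((B ξ x : ℝ) * I)))
      (fun y => f y * cexp ((B ξ y : ℝ) * I))]
    congr 1
    simp only [hA, ← integral_conj, map_mul]
  have h5 : ∀ ξ, conj (A ξ) * A ξ = ((‖A ξ‖ ^ 2 : ℝ) : ℂ) := fun ξ => by
    rw [mul_comm, Complex.mul_conj, Complex.normSq_eq_norm_sq]
  -- assemble
  rw [@norm_sq_eq_re_inner ℂ, h1, h2, h3]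
  simp_rw [h4, h5]
  rw [integral_complex_ofReal, RCLike.re_to_complex, Complex.ofReal_re]

/-! ### Covariance under automorphisms -/

/-- **Covariance of the spectral measure.** If the matrix coefficients of `w` are those of `v`
twisted by a linear map `A` of `V` — `⟪w, U x w⟫ = ⟪v, U (A x) v⟫` for all `x`, e.g. `w = D v`
for a unitary `D` with `D⁻¹ U_x D = U_{A x}` — and `A'` is `B`-adjoint to `A`
(`B(A' ξ, x) = B(ξ, A x)`), then `μ_w` is the push-forward of `μ_v` under `A'`.
[cite: Folland1995, Thm. 4.44] -/
theorem spectralMeasure_eq_map_of_matrixCoeff_eq (hB : B.Nondegenerate) (v w : H) (A A' : V →ₗ[ℝ] V)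
    (hA : ∀ ξ x, B (A' ξ) x = B ξ (A x)) (h : ∀ x, U.matrixCoeff w w x = U.matrixCoeff v v (A x)) :
    U.spectralMeasure B hB w = (U.spectralMeasure B hB v).map A' := by
  have hA'm : Measurable A' := (LinearMap.continuous_of_finiteDimensional A').measurable
  haveI : IsFiniteMeasure ((U.spectralMeasure B hB v).map A') := Measure.isFiniteMeasure_map _ _
  refine U.spectralMeasure_unique B hB w fun x => ?_
  have hcont : Continuous fun ξ : V => cexp ((B ξ x : ℝ) * I) :=
    (continuous_cexp_bilin_uncurry B).comp (continuous_id.prodMk continuous_const)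
  rw [integral_map hA'm.aemeasurable hcont.aestronglyMeasurable, ← matrixCoeff_apply, h x,
    U.matrixCoeff_eq_integral_spectralMeasure B hB v (A x)]
  simp_rw [hA]

/-- **Plancherel under a twist.** In the situation of `spectralMeasure_eq_map_of_matrixCoeff_eq`,
`‖∫ f(x) U_x w dλ‖² = ∫ |∫ f(x) exp(i B(A' ξ, x)) dλ(x)|² dμ_v(ξ)`. [cite: Folland1995, Thm. 4.44] -/
theorem norm_sq_integral_smul_map_eq_of_matrixCoeff_eq (hB : B.Nondegenerate) (v w : H) (A A' : V →ₗ[ℝ] V)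
    (hA : ∀ ξ x, B (A' ξ) x = B ξ (A x)) (h : ∀ x, U.matrixCoeff w w x = U.matrixCoeff v v (A x))
    (lam : Measure V) [SFinite lam] {f : V → ℂ} (hf : Integrable f lam) :
    ‖∫ x, f x • U (Multiplicative.ofAdd x) w ∂lam‖ ^ 2 =
      ∫ ξ, ‖∫ x, f x * cexp ((B (A' ξ) x : ℝ) * I) ∂lam‖ ^ 2 ∂(U.spectralMeasure B hB v) := by
  have hA'c : Continuous A' := LinearMap.continuous_of_finiteDimensional A'
  have hAm : AEStronglyMeasurable (fun ξ => ‖∫ x, f x * cexp ((B ξ x : ℝ) * I) ∂lam‖ ^ 2)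
      ((U.spectralMeasure B hB v).map A') :=
    (((continuous_integral_mul_cexp_bilin B lam hf).norm).pow 2).aestronglyMeasurable
  rw [U.norm_sq_integral_smul_map_eq B hB w lam hf,
    U.spectralMeasure_eq_map_of_matrixCoeff_eq B hB v w A A' hA h,
    integral_map hA'c.measurable.aemeasurable hAm]

end Spectral

/-! ### Dilation integrals over an abelian group acting linearly on `V` -/

section Dilation

open scoped ENNReal
open MeasureTheory Complex

variable {V : Type*} [NormedAddCommGroup V] [NormedSpace ℝ V] [FiniteDimensional ℝ V]
  [MeasurableSpace V] [BorelSpace V]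
  {H : Type*} [NormedAddCommGroup H] [InnerProductSpace ℂ H] [CompleteSpace H]
  (U : UnitaryRep (Multiplicative V) H) (B : LinearMap.BilinForm ℝ V)
  {Y : Type*} [CommGroup Y] [MeasurableSpace Y] [MeasurableMul Y]

omit [FiniteDimensional ℝ V] [BorelSpace V] in
/-- The `B`-Fourier transform of an `L¹` kernel is bounded by `‖f‖₁`. [folklore] -/
theorem _root_.Literature.Analysis.UnboundedOperators.norm_integral_mul_cexp_bilin_le
    (lam : Measure V) (f : V → ℂ) (ξ : V) :
    ‖∫ x, f x * cexp ((B ξ x : ℝ) * I) ∂lam‖ ≤ ∫ x, ‖f x‖ ∂lam := by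
  refine (norm_integral_le_integral_norm _).trans (le_of_eq (integral_congr_ae (ae_of_all _ fun x => ?_)))
  dsimp only
  rw [norm_mul, norm_cexp_bilin_mul_I, mul_one]

/-- **The dilation integral** (the abelian half of the Kirillov `L²`-bound). Let an abelian group `Y`
act linearly on `V` by `B`-symmetric maps (`act`; e.g. the unit group of a commutative real algebra
`V` acting by multiplication, with `B` a trace form), let `v ∈ H` and let `w : Y → H` be a family
whose matrix coefficients are the dilated ones, `⟪w_y, U_x w_y⟫ = ⟪v, U_{y⁻¹ x} v⟫` (e.g. `w_y = D_y v`
for unitaries with `D_y⁻¹ U_x D_y = U_{y⁻¹ x}`). Let `ν` be a left-invariant measure on `Y`, `χ` a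
multiplicative weight on `Y` and `W ≥ 0` a measurable weight on `V` with `W(y · ξ) = χ(y) W(ξ)`,
`W(ξ₀) = 1`, and `f ∈ L¹(V)` a kernel whose `B`-Fourier transform `f̂` vanishes off the orbit `Y · ξ₀`.
Then

  `∫_Y χ(y) ‖∫ f(x) U_x w_y dλ(x)‖² dν(y) ≤ (∫_Y χ(z) |f̂(z⁻¹ · ξ₀)|² dν(z)) · ∫_V W(ξ) dμ_v(ξ)`

(Plancherel for each `w_y` on the spectral measure of `v` — covariance under the `B`-symmetric map
`y⁻¹` —, Tonelli, and the substitution `y = u z` in the inner integral over the orbit point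
`ξ = u · ξ₀`, which is where left invariance enters; off the orbit the inner integral vanishes).
[cite: Folland1995, Thm. 4.44] -/
theorem lintegral_weight_mul_norm_sq_integral_smul_le (hB : B.Nondegenerate) (act : Y →* (V →ₗ[ℝ] V))
    (hact : Measurable fun p : Y × V => act p.1⁻¹ p.2)
    (hBact : ∀ (y : Y) (ξ x : V), B (act y ξ) x = B ξ (act y x)) (v : H) (w : Y → H)
    (hw : ∀ y x, U.matrixCoeff (w y) (w y) x = U.matrixCoeff v v (act y⁻¹ x))
    (ν : Measure Y) [ν.IsMulLeftInvariant] [SFinite ν]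
    (χ : Y → ℝ≥0∞) (hχm : Measurable χ) (hχ : ∀ y z, χ (y * z) = χ y * χ z)
    (W : V → ℝ≥0∞) (hWm : Measurable W) (ξ₀ : V) (hW : ∀ (y : Y) (ξ : V), W (act y ξ) = χ y * W ξ)
    (hW0 : W ξ₀ = 1)
    (lam : Measure V) [SFinite lam] {f : V → ℂ} (hf : Integrable f lam)
    (hf0 : ∀ ξ : V, ξ ∉ Set.range (fun u : Y => act u ξ₀) → ∫ x, f x * cexp ((B ξ x : ℝ) * I) ∂lam = 0) :
    ∫⁻ y, χ y * ENNReal.ofReal (‖∫ x, f x • U (Multiplicative.ofAdd x) (w y) ∂lam‖ ^ 2) ∂ν ≤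
      (∫⁻ z, χ z * ENNReal.ofReal (‖∫ x, f x * cexp ((B (act z⁻¹ ξ₀) x : ℝ) * I) ∂lam‖ ^ 2) ∂ν) *
        ∫⁻ ξ, W ξ ∂(U.spectralMeasure B hB v) := by
  obtain ⟨fhat, hfhat⟩ : ∃ F : V → ℂ, ∀ ξ, F ξ = ∫ x, f x * cexp ((B ξ x : ℝ) * I) ∂lam :=
    ⟨_, fun _ => rfl⟩
  have hfhat_c : Continuous fhat := by
    have h := continuous_integral_mul_cexp_bilin B lam hf
    refine h.congr fun ξ => (hfhat ξ).symm
  obtain ⟨g, hg⟩ : ∃ G : Y → V → ℝ≥0∞, ∀ y ξ, G y ξ = ENNReal.ofReal (‖fhat (act y⁻¹ ξ)‖ ^ 2) :=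
    ⟨_, fun _ _ => rfl⟩
  have hgm : Measurable (Function.uncurry g) := by
    have h : Function.uncurry g = fun p : Y × V => ENNReal.ofReal (‖fhat (act p.1⁻¹ p.2)‖ ^ 2) := by
      funext p; exact hg p.1 p.2
    rw [h]
    exact ENNReal.measurable_ofReal.comp ((continuous_pow 2).measurable.comp
      (continuous_norm.measurable.comp (hfhat_c.measurable.comp hact)))
  have hgm_y : ∀ y : Y, Measurable (g y) := fun y => hgm.comp measurable_prodMk_left
  -- pointwise Plancherel, in `ℝ≥0∞`
  have hpt : ∀ y : Y, ENNReal.ofReal (‖∫ x, f x • U (Multiplicative.ofAdd x) (w y) ∂lam‖ ^ 2) =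
      ∫⁻ ξ, g y ξ ∂(U.spectralMeasure B hB v) := by
    intro y
    have hint : Integrable (fun ξ => ‖fhat (act y⁻¹ ξ)‖ ^ 2) (U.spectralMeasure B hB v) := by
      refine Integrable.mono' (integrable_const ((∫ x, ‖f x‖ ∂lam) ^ 2))
        ((continuous_pow 2).comp_aestronglyMeasurable (continuous_norm.comp_aestronglyMeasurable
          ((hfhat_c.measurable.comp (hact.comp measurable_prodMk_left)).aestronglyMeasurable)))
        (ae_of_all _ fun ξ => ?_)
      rw [Real.norm_eq_abs, abs_of_nonneg (sq_nonneg _), hfhat]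
      exact pow_le_pow_left₀ (norm_nonneg _) (norm_integral_mul_cexp_bilin_le B lam f _) 2
    rw [U.norm_sq_integral_smul_map_eq_of_matrixCoeff_eq B hB v (w y) (act y⁻¹) (act y⁻¹)
        (hBact y⁻¹) (hw y) lam hf]
    simp_rw [← hfhat]
    rw [ofReal_integral_eq_lintegral_ofReal hint (ae_of_all _ fun ξ => sq_nonneg _)]
    exact lintegral_congr fun ξ => (hg y ξ).symm
  -- Tonelli
  have hswap : ∫⁻ y, χ y * ∫⁻ ξ, g y ξ ∂(U.spectralMeasure B hB v) ∂ν =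
      ∫⁻ ξ, ∫⁻ y, χ y * g y ξ ∂ν ∂(U.spectralMeasure B hB v) := by
    have h1 : ∀ y : Y, χ y * ∫⁻ ξ, g y ξ ∂(U.spectralMeasure B hB v) =
        ∫⁻ ξ, χ y * g y ξ ∂(U.spectralMeasure B hB v) := fun y =>
      (lintegral_const_mul _ (hgm_y y)).symm
    simp_rw [h1]
    exact lintegral_lintegral_swap ((hχm.comp measurable_fst).mul hgm).aemeasurable
  -- the inner integral over the orbit
  have hgm_z0 : Measurable fun z : Y => g z ξ₀ := hgm.comp (measurable_id.prodMk measurable_const)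
  have hinner : ∀ ξ : V, ∫⁻ y, χ y * g y ξ ∂ν ≤ (∫⁻ z, χ z * g z ξ₀ ∂ν) * W ξ := by
    intro ξ
    by_cases hξ : ξ ∈ Set.range (fun u : Y => act u ξ₀)
    · obtain ⟨u, rfl⟩ := hξ
      have hsub : ∫⁻ y, χ y * g y (act u ξ₀) ∂ν = ∫⁻ z, χ (u * z) * g (u * z) (act u ξ₀) ∂ν :=
        (lintegral_mul_left_eq_self (μ := ν) (fun y => χ y * g y (act u ξ₀)) u).symm
      have hpt' : ∀ z : Y, χ (u * z) * g (u * z) (act u ξ₀) = χ u * (χ z * g z ξ₀) := by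
        intro z
        rw [hg, hg, hχ, ← Module.End.mul_apply, ← map_mul, mul_inv_rev, inv_mul_cancel_right, mul_assoc]
      rw [hsub]
      simp_rw [hpt']
      have hm : Measurable fun z : Y => χ z * g z ξ₀ := hχm.mul hgm_z0
      rw [lintegral_const_mul (χ u) hm, hW, hW0, mul_one]
      exact le_of_eq (mul_comm _ _)
    · have hzero : ∀ y : Y, g y ξ = 0 := by
        intro y
        have hnu : act y⁻¹ ξ ∉ Set.range (fun u : Y => act u ξ₀) := by
          rintro ⟨u, hu⟩
          apply hξ
          refine ⟨y * u, ?_⟩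
          show act (y * u) ξ₀ = ξ
          have hu' : act u ξ₀ = act y⁻¹ ξ := hu
          rw [map_mul, Module.End.mul_apply, hu', ← Module.End.mul_apply, ← map_mul, mul_inv_cancel,
            map_one, Module.End.one_apply]
        rw [hg, hfhat, hf0 _ hnu, norm_zero, zero_pow two_ne_zero, ENNReal.ofReal_zero]
      simp_rw [hzero, mul_zero, lintegral_zero]
      exact zero_le
  -- assemble
  have hmain : ∫⁻ y, χ y * ENNReal.ofReal (‖∫ x, f x • U (Multiplicative.ofAdd x) (w y) ∂lam‖ ^ 2) ∂ν ≤
      (∫⁻ z, χ z * g z ξ₀ ∂ν) * ∫⁻ ξ, W ξ ∂(U.spectralMeasure B hB v) :=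
    calc ∫⁻ y, χ y * ENNReal.ofReal (‖∫ x, f x • U (Multiplicative.ofAdd x) (w y) ∂lam‖ ^ 2) ∂ν
        = ∫⁻ y, χ y * ∫⁻ ξ, g y ξ ∂(U.spectralMeasure B hB v) ∂ν := by simp_rw [hpt]
      _ = ∫⁻ ξ, ∫⁻ y, χ y * g y ξ ∂ν ∂(U.spectralMeasure B hB v) := hswap
      _ ≤ ∫⁻ ξ, (∫⁻ z, χ z * g z ξ₀ ∂ν) * W ξ ∂(U.spectralMeasure B hB v) := lintegral_mono hinner
      _ = (∫⁻ z, χ z * g z ξ₀ ∂ν) * ∫⁻ ξ, W ξ ∂(U.spectralMeasure B hB v) := lintegral_const_mul _ hWm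
  refine hmain.trans (le_of_eq ?_)
  congr 1
  exact lintegral_congr fun z => by rw [hg, hfhat]

end Dilation

end UnitaryRep

end Literature.Analysis.UnboundedOperators
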